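import Literature.NumberTheory.EllipticCurves.BhargavaShankarEq31FrontierProofs
import Literature.NumberTheory.EllipticCurves.BinaryQuarticDoubleRootStructureProofs
import HarnessLib

/-!
# Bhargava–Shankar, Prop. 5.13 / Prop. 3.18 (weight half): forms that are `PGL₂(ℚ_p)`- but not
# `PGL₂(ℤ_p)`-equivalent have `p² ∣ Δ` — the Cartan decomposition of `GL₂(ℚ_p)` and the reduction
# to `γ = diag(pⁿ, 1)`

`Proofs` companion (theorems only: no definitions, no named facts) of `BinaryQuarticForms.lean` and
`BinaryQuarticStabilizer.lean` (the twisted action `γ · f = (det γ)⁻² f((x,y)γ)`), completing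
`BinaryQuartic.sq_dvd_disc_of_twisted_diagonal_integral` of `BhargavaShankarEq31FrontierProofs`
(the case `γ = diag(pᵏ, 1)` over `ℤ`, whose docstring notes: "the reduction of a general
`γ ∈ PGL₂(ℚ_p) ∖ PGL₂(ℤ_p)` to this representative — the Cartan decomposition — is not carried out
here").

Source. M. Bhargava, A. Shankar, *Binary quartic forms having bounded invariants, and the
boundedness of the average rank of elliptic curves*, Ann. of Math. (2) 181 (2015) 191–242, proof of
Prop. 5.13 of the held arXiv text `arXiv:1006.1002v2` (= Prop. 3.18 of the published version), first
paragraph: *"If `f, f' ∈ V_ℤ` are `PGL₂(ℚ_p)`-equivalent but not `PGL₂(ℤ_p)`-equivalent, then by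
replacing `f` with a form that is `PGL₂(ℤ_p)`-equivalent to it, we may assume that `f = γ · f'`,
where `γ = diag(pⁿ, p⁻ⁿ)`. It is then clear that `f` is not maximal"* (published version: "… then
`p² ∣ Δ(f)`").

## Contents

* `exists_cartan_of_isUnit_entry`, `exists_cartan_decomposition` — **the Cartan decomposition of
  `GL₂(ℚ_p)`**: every `γ ∈ M₂(ℚ_p)` with `det γ ≠ 0` is `c · k₁ · diag(pⁿ, 1) · k₂` with
  `c ∈ ℚ_pˣ`, `n ≥ 0` and `k₁, k₂ ∈ GL₂(ℤ_p)` (given with explicit integral inverses), by scaling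
  to an integral matrix with a unit entry, permuting it to the corner, and one step of row and
  column reduction;
* `BinaryQuartic.sq_dvd_disc_of_twisted_diagonal_integral_padicInt` — the diagonal case over
  `ℤ_p` (as in the source: `p ∣ d`, `p² ∣ e`, hence `p² ∣ Δ`);
* `BinaryQuartic.sq_dvd_disc_of_pgl2Q_equiv_not_pgl2Z_equiv` — **if `f, f' ∈ V_{ℤ_p}` are
  `PGL₂(ℚ_p)`-equivalent (`γ · f = f'`, `γ ∈ GL₂(ℚ_p)`) but not `PGL₂(ℤ_p)`-equivalent (no
  `k ∈ GL₂(ℤ_p)` with `k · f = f'`), then `p² ∣ Δ(f)`**, for every prime `p`.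

Together with `BinaryQuartic.sq_dvd_disc_of_not_isSoluble` (`BinaryQuarticBadReductionSolubilityProofs`:
a form that is not `ℚ_p`-soluble has `p² ∣ Δ`, `p ≥ 5`) this is the statement "`f` bad at `p` `⇒`
`p² ∣ Δ(f)`" of the proof of Prop. 5.13 / Prop. 3.18.

## References

* M. Bhargava, A. Shankar, Ann. of Math. (2) 181 (2015) 191–242 = arXiv:1006.1002, Prop. 5.13 of
  the arXiv v2 text = Prop. 3.18 of the published version, proof, first paragraph.
  [cite: BhargavaShankarAnnals2015, Prop. 5.13, proof (arXiv:1006.1002v2 numbering)]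
* The Cartan (`KAK`) decomposition of `GL₂` over a discretely valued field. [folklore]
-/

noncomputable section

open scoped Classical

namespace Literature.NumberTheory.EllipticCurves

section Cartan

variable {p : ℕ} [Fact p.Prime]

/-- **Cartan decomposition, core step.** An integral `2 × 2` matrix over `ℤ_p` with a unit in the
upper left corner and nonzero determinant is `k₁ · diag(pⁿ, 1) · k₂` with `k₁, k₂` integral and
invertible over `ℤ_p` (explicit inverses are provided): one step of row and column reduction
brings it to `diag(u, w)`, `w = pⁿ·(unit)`. [folklore] -/
theorem exists_cartan_of_isUnit_entry {M : Matrix (Fin 2) (Fin 2) ℤ_[p]}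
    (hu : IsUnit (M 0 0)) (hdet : M.det ≠ 0) :
    ∃ (n : ℕ) (k₁ k₁' k₂ k₂' : Matrix (Fin 2) (Fin 2) ℤ_[p]),
      k₁' * k₁ = 1 ∧ k₂ * k₂' = 1 ∧ M = k₁ * !![(p : ℤ_[p]) ^ n, 0; 0, 1] * k₂ := by
  obtain ⟨uu, huu⟩ := hu
  set ui : ℤ_[p] := ↑(uu⁻¹) with huidef
  have huui : M 0 0 * ui = 1 := by rw [← huu, huidef]; exact Units.mul_inv uu
  set w := M 1 1 - M 1 0 * ui * M 0 1 with hwdef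
  have hdetw : M.det = M 0 0 * w := by
    rw [Matrix.det_fin_two, hwdef]
    linear_combination (M 1 0 * M 0 1) * huui
  have hw0 : w ≠ 0 := fun h ↦ hdet (by rw [hdetw, h, mul_zero])
  set n := w.valuation with hn
  set wu : ℤ_[p] := ↑(PadicInt.unitCoeff hw0) with hwu
  set wui : ℤ_[p] := ↑(PadicInt.unitCoeff hw0)⁻¹ with hwui
  have hwwu : w = wu * (p : ℤ_[p]) ^ n := by rw [hwu, hn]; exact PadicInt.unitCoeff_spec hw0
  have hwuwui : wu * wui = 1 := by rw [hwu, hwui]; exact Units.mul_inv _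
  refine ⟨n, !![0, M 0 0; wu, M 1 0], !![-(wui * M 1 0 * ui), wui; ui, 0], !![0, 1; 1, ui * M 0 1],
    !![-(ui * M 0 1), 1; 1, 0], ?_, ?_, ?_⟩
  · rw [Matrix.mul_fin_two, Matrix.one_fin_two]
    ext i j
    fin_cases i <;> fin_cases j
    · simp; linear_combination hwuwui
    · simp; linear_combination (-(wui * M 1 0)) * huui
    · simp
    · simp; linear_combination huui
  · rw [Matrix.mul_fin_two, Matrix.one_fin_two]
    ext i j
    fin_cases i <;> fin_cases j <;> simp
  · rw [Matrix.mul_fin_two, Matrix.mul_fin_two]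
    conv_lhs => rw [Matrix.eta_fin_two M]
    ext i j
    fin_cases i <;> fin_cases j
    · simp
    · simp; linear_combination (-(M 0 1)) * huui
    · simp
    · simp; rw [← hwwu, hwdef]; ring

/-- Swapping rows or columns: the permutation matrix `S = (0 1; 1 0)` is its own inverse. [folklore] -/
theorem swap_mul_swap {R : Type*} [CommRing R] :
    (!![0, 1; 1, 0] : Matrix (Fin 2) (Fin 2) R) * !![0, 1; 1, 0] = 1 := by
  rw [Matrix.mul_fin_two, Matrix.one_fin_two]
  ext i j; fin_cases i <;> fin_cases j <;> simp

/-- **Cartan decomposition of `GL₂(ℚ_p)`.** Every `γ ∈ M₂(ℚ_p)` with `det γ ≠ 0` factors as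
`γ = c · k₁ · diag(pⁿ, 1) · k₂` with `c ≠ 0`, `n ∈ ℕ`, and `k₁, k₂` integral matrices invertible
over `ℤ_p` (with explicit integral inverses `k₁'k₁ = 1`, `k₂k₂' = 1`). Moreover `n = 0` exactly
when `γ ∈ ℚ_pˣ · GL₂(ℤ_p)`; here only the factorisation is recorded. [folklore] -/
theorem exists_cartan_decomposition {γ : Matrix (Fin 2) (Fin 2) ℚ_[p]} (hγ : γ.det ≠ 0) :
    ∃ (c : ℚ_[p]) (n : ℕ) (k₁ k₁' k₂ k₂' : Matrix (Fin 2) (Fin 2) ℤ_[p]),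
      c ≠ 0 ∧ k₁' * k₁ = 1 ∧ k₂ * k₂' = 1 ∧
      γ = c • (k₁.map PadicInt.Coe.ringHom * !![(p : ℚ_[p]) ^ n, 0; 0, 1]
        * k₂.map PadicInt.Coe.ringHom) := by
  -- an entry of maximal norm
  obtain ⟨⟨i₀, j₀⟩, -, hmax⟩ := Finset.exists_max_image Finset.univ
    (fun ij : Fin 2 × Fin 2 ↦ ‖γ ij.1 ij.2‖) Finset.univ_nonempty
  set c := γ i₀ j₀ with hc
  have hc0 : c ≠ 0 := by
    intro h0
    apply hγ
    have hall : ∀ i j, γ i j = 0 := fun i j ↦ by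
      have := hmax (i, j) (Finset.mem_univ _)
      dsimp only at this
      rw [h0, norm_zero] at this
      exact norm_le_zero_iff.mp this
    rw [Matrix.det_fin_two, hall 0 0, hall 0 1]; ring
  -- the integral matrix `c⁻¹ γ`
  have hint : ∀ i j, ‖c⁻¹ * γ i j‖ ≤ 1 := fun i j ↦ by
    rw [norm_mul, norm_inv]
    have := hmax (i, j) (Finset.mem_univ _)
    dsimp only at this
    have hcpos : 0 < ‖c‖ := norm_pos_iff.mpr hc0
    rw [inv_mul_le_iff₀ hcpos, mul_one]
    exact this
  set N : Matrix (Fin 2) (Fin 2) ℤ_[p] := fun i j ↦ ⟨c⁻¹ * γ i j, hint i j⟩ with hN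
  have hNmap : N.map PadicInt.Coe.ringHom = c⁻¹ • γ := by
    ext i j; simp [hN]
  have hNdet : N.det ≠ 0 := by
    intro h
    have : (N.map PadicInt.Coe.ringHom).det = 0 := by
      rw [← RingHom.mapMatrix_apply, ← RingHom.map_det, h, map_zero]
    rw [hNmap, Matrix.det_smul, Fintype.card_fin] at this
    exact mul_ne_zero (pow_ne_zero _ (inv_ne_zero hc0)) hγ this
  have hN1 : N i₀ j₀ = 1 := by
    apply Subtype.ext
    change c⁻¹ * γ i₀ j₀ = 1
    rw [← hc, inv_mul_cancel₀ hc0]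
  -- permute the unit entry to the corner: `M = P N Q` with `P, Q ∈ {1, S}`
  set S : Matrix (Fin 2) (Fin 2) ℤ_[p] := !![0, 1; 1, 0] with hS
  have hSS : S * S = 1 := swap_mul_swap
  obtain ⟨P, Q, hPP, hQQ, hM00⟩ : ∃ P Q : Matrix (Fin 2) (Fin 2) ℤ_[p],
      P * P = 1 ∧ Q * Q = 1 ∧ (P * N * Q) 0 0 = 1 := by
    fin_cases i₀ <;> fin_cases j₀
    · exact ⟨1, 1, by simp, by simp, by simpa using hN1⟩
    · refine ⟨1, S, by simp, hSS, ?_⟩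
      rw [Matrix.one_mul, Matrix.eta_fin_two N, hS, Matrix.mul_fin_two]
      simpa using hN1
    · refine ⟨S, 1, hSS, by simp, ?_⟩
      rw [Matrix.mul_one, Matrix.eta_fin_two N, hS, Matrix.mul_fin_two]
      simpa using hN1
    · refine ⟨S, S, hSS, hSS, ?_⟩
      rw [Matrix.eta_fin_two N, hS, Matrix.mul_fin_two, Matrix.mul_fin_two]
      simpa using hN1
  set M := P * N * Q with hM
  have hMdet : M.det ≠ 0 := by
    rw [hM, Matrix.det_mul, Matrix.det_mul]
    have hP : P.det ≠ 0 := fun h ↦ by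
      have := congrArg Matrix.det hPP
      rw [Matrix.det_mul, h, mul_zero, Matrix.det_one] at this
      exact zero_ne_one this
    have hQ : Q.det ≠ 0 := fun h ↦ by
      have := congrArg Matrix.det hQQ
      rw [Matrix.det_mul, h, mul_zero, Matrix.det_one] at this
      exact zero_ne_one this
    exact mul_ne_zero (mul_ne_zero hP hNdet) hQ
  obtain ⟨n, k₁, k₁', k₂, k₂', hk₁, hk₂, hMeq⟩ :=
    exists_cartan_of_isUnit_entry (M := M) (by rw [hM00]; exact isUnit_one) hMdet
  -- `N = P M Q`, so `γ = c · (P k₁) D (k₂ Q)`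
  have hNeq : N = P * M * Q := by
    rw [hM, ← Matrix.mul_assoc, ← Matrix.mul_assoc, hPP, Matrix.one_mul, Matrix.mul_assoc, hQQ,
      Matrix.mul_one]
  refine ⟨c, n, P * k₁, k₁' * P, k₂ * Q, Q * k₂', hc0, ?_, ?_, ?_⟩
  · rw [Matrix.mul_assoc, ← Matrix.mul_assoc P P k₁, hPP, Matrix.one_mul, hk₁]
  · rw [Matrix.mul_assoc, ← Matrix.mul_assoc Q Q k₂', hQQ, Matrix.one_mul, hk₂]
  · have hγ' : γ = c • N.map PadicInt.Coe.ringHom := by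
      rw [hNmap, smul_smul, mul_inv_cancel₀ hc0, one_smul]
    rw [hγ', hNeq, hMeq]
    congr 1
    have hassoc : P * (k₁ * !![(p : ℤ_[p]) ^ n, 0; 0, 1] * k₂) * Q
        = (P * k₁) * !![(p : ℤ_[p]) ^ n, 0; 0, 1] * (k₂ * Q) := by
      simp only [Matrix.mul_assoc]
    rw [hassoc, Matrix.map_mul, Matrix.map_mul]
    congr 2
    ext i j; fin_cases i <;> fin_cases j <;> simp

end Cartan

namespace BinaryQuartic

variable {p : ℕ} [Fact p.Prime]

/-- **The diagonal case over `ℤ_p`** (as `BinaryQuartic.sq_dvd_disc_of_twisted_diagonal_integral`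
over `ℤ`): if `(pⁿ)² · h = g((x,y)·diag(pⁿ, 1))` with `g, h ∈ V_{ℤ_p}` and `n ≥ 1`, then `p ∣ d(g)`,
`p² ∣ e(g)`, hence `p² ∣ Δ(g)`. [cite: BhargavaShankarAnnals2015, Prop. 5.13, proof (arXiv:1006.1002v2 numbering)] -/
theorem sq_dvd_disc_of_twisted_diagonal_integral_padicInt (g h : BinaryQuartic ℤ_[p]) {n : ℕ}
    (hn : 1 ≤ n) (hgh : (((p : ℤ_[p]) ^ n) ^ 2) • h = g.subst !![(p : ℤ_[p]) ^ n, 0; 0, 1]) :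
    (p : ℤ_[p]) ^ 2 ∣ g.disc := by
  rw [subst_diagonal] at hgh
  have hp : (p : ℤ_[p]) ≠ 0 := by exact_mod_cast (Fact.out : p.Prime).ne_zero
  have hpn : ((p : ℤ_[p]) ^ n) ≠ 0 := pow_ne_zero _ hp
  have hd' : ((p : ℤ_[p]) ^ n) ^ 2 * h.d = g.d * (p : ℤ_[p]) ^ n * 1 ^ 3 := by
    have := congrArg BinaryQuartic.d hgh; simpa using this
  have he' : ((p : ℤ_[p]) ^ n) ^ 2 * h.e = g.e * 1 ^ 4 := by
    have := congrArg BinaryQuartic.e hgh; simpa using this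
  have hd : (p : ℤ_[p]) ∣ g.d := by
    have h1 : g.d = (p : ℤ_[p]) ^ n * h.d := by
      have h2 : (g.d - (p : ℤ_[p]) ^ n * h.d) * (p : ℤ_[p]) ^ n = 0 := by
        linear_combination -hd'
      exact sub_eq_zero.mp ((mul_eq_zero.mp h2).resolve_right hpn)
    rw [h1]
    exact dvd_mul_of_dvd_left (dvd_pow_self _ (by omega)) _
  have he : (p : ℤ_[p]) ^ 2 ∣ g.e := by
    have h1 : g.e = ((p : ℤ_[p]) ^ n) ^ 2 * h.e := by linear_combination -he'
    rw [h1, ← pow_mul]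
    exact dvd_mul_of_dvd_left (pow_dvd_pow _ (by omega)) _
  exact sq_dvd_disc_of_dvd_d_of_sq_dvd_e g hd he

/-- `Δ(μ • f) = μ⁶ Δ(f)` over a domain of characteristic `0`. [folklore] -/
theorem disc_smul_form {R : Type*} [CommRing R] [IsDomain R] [CharZero R] (μ : R) (f : BinaryQuartic R) :
    (μ • f).disc = μ ^ 6 * f.disc := by
  have h27 : (27 : R) ≠ 0 := by norm_num
  apply mul_left_cancel₀ h27
  rw [twentySeven_mul_disc, I_smul, J_smul, mul_left_comm, twentySeven_mul_disc]
  ring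

/-- The twisted action of an integral matrix with unit determinant preserves integrality: for
`k ∈ GL₂(ℤ_p)` and `f ∈ V_{ℤ_p}`, `k · f = (u² · f((x,y)k))` with `u = (det k)⁻¹ ∈ ℤ_p`. [folklore] -/
theorem twist_map_of_det_unit (f : BinaryQuartic ℤ_[p]) {k : Matrix (Fin 2) (Fin 2) ℤ_[p]}
    {u : ℤ_[p]} (hu : k.det * u = 1) :
    twist (k.map PadicInt.Coe.ringHom) (f.map PadicInt.Coe.ringHom)
      = ((u ^ 2) • f.subst k).map PadicInt.Coe.ringHom := by
  set ι := PadicInt.Coe.ringHom (p := p) with hι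
  have hdet : (k.map ι).det = ι k.det := by
    rw [← RingHom.mapMatrix_apply, ← RingHom.map_det]
  have hu' : ι k.det * ι u = 1 := by rw [← map_mul, hu, map_one]
  have hinv : ((ι k.det) ^ 2)⁻¹ = (ι u) ^ 2 := by
    rw [← inv_pow, ← eq_inv_of_mul_eq_one_right hu']
  rw [twist, hdet, hinv, map_smul_form, map_subst, map_pow]

/-- **Bhargava–Shankar, Prop. 5.13 / Prop. 3.18, weight half.** Let `f, f' ∈ V_{ℤ_p}`. If some
`γ ∈ GL₂(ℚ_p)` carries `f` to `f'` under the twisted action (`f` and `f'` are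
`PGL₂(ℚ_p)`-equivalent) but no `k ∈ GL₂(ℤ_p)` does (they are not `PGL₂(ℤ_p)`-equivalent), then
`p² ∣ Δ(f)`. Proof: `γ = c·k₁·diag(pⁿ,1)·k₂` (Cartan); `n ≥ 1` as otherwise `k₁k₂` would do; then
`diag(pⁿ,1) · (k₂ · f) = k₁⁻¹ · f'` is integral and the diagonal case applies to `k₂ · f`, whose
discriminant is a unit multiple of `Δ(f)`. [cite: BhargavaShankarAnnals2015, Prop. 5.13, proof (arXiv:1006.1002v2 numbering)] -/
theorem sq_dvd_disc_of_pgl2Q_equiv_not_pgl2Z_equiv (f f' : BinaryQuartic ℤ_[p])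
    {γ : Matrix (Fin 2) (Fin 2) ℚ_[p]} (hγ : γ.det ≠ 0)
    (h : twist γ (f.map PadicInt.Coe.ringHom) = f'.map PadicInt.Coe.ringHom)
    (hnot : ¬ ∃ k : Matrix (Fin 2) (Fin 2) ℤ_[p], IsUnit k.det ∧
      twist (k.map PadicInt.Coe.ringHom) (f.map PadicInt.Coe.ringHom) = f'.map PadicInt.Coe.ringHom) :
    (p : ℤ_[p]) ^ 2 ∣ f.disc := by
  obtain ⟨c, n, k₁, k₁', k₂, k₂', hc0, hk₁, hk₂, hγeq⟩ := exists_cartan_decomposition hγ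
  set ι := PadicInt.Coe.ringHom (p := p) with hι
  have hp : (p : ℤ_[p]) ≠ 0 := by exact_mod_cast (Fact.out : p.Prime).ne_zero
  -- determinants of `k₁, k₂` are units
  have hk₁u : k₁.det * k₁'.det = 1 := by
    rw [mul_comm, ← Matrix.det_mul, hk₁, Matrix.det_one]
  have hk₂u : k₂.det * k₂'.det = 1 := by rw [← Matrix.det_mul, hk₂, Matrix.det_one]
  have hk₁'u : k₁'.det * k₁.det = 1 := by rw [mul_comm]; exact hk₁u
  -- `n ≥ 1`: otherwise `k₁ k₂ ∈ GL₂(ℤ_p)` carries `f` to `f'`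
  have hn : 1 ≤ n := by
    by_contra hn0
    have hn0' : n = 0 := by omega
    apply hnot
    refine ⟨k₁ * k₂, ?_, ?_⟩
    · rw [Matrix.det_mul]
      exact (isUnit_iff_exists_inv.mpr ⟨_, hk₁u⟩).mul (isUnit_iff_exists_inv.mpr ⟨_, hk₂u⟩)
    · rw [← h, hγeq, hn0', pow_zero, twist_smul hc0]
      congr 1
      rw [Matrix.map_mul, show (!![1, 0; 0, 1] : Matrix (Fin 2) (Fin 2) ℚ_[p]) = 1 from
        (Matrix.one_fin_two).symm, Matrix.mul_one]
  -- the integral forms `g = k₂ · f` and `h₀ = k₁⁻¹ · f'`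
  set g : BinaryQuartic ℤ_[p] := (k₂'.det ^ 2) • f.subst k₂ with hg
  set h₀ : BinaryQuartic ℤ_[p] := (k₁.det ^ 2) • f'.subst k₁' with hh₀
  have hgmap : twist (k₂.map ι) (f.map ι) = g.map ι := by
    rw [hg, hι]; exact twist_map_of_det_unit f hk₂u
  have hh₀map : twist (k₁'.map ι) (f'.map ι) = h₀.map ι := by
    rw [hh₀, hι]; exact twist_map_of_det_unit f' hk₁'u
  -- `diag(pⁿ,1) · g = h₀` over `ℚ_p`
  set D : Matrix (Fin 2) (Fin 2) ℚ_[p] := !![(p : ℚ_[p]) ^ n, 0; 0, 1] with hD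
  have hDdet : D.det = (p : ℚ_[p]) ^ n := by rw [hD, Matrix.det_fin_two_of]; ring
  have hDdet0 : D.det ≠ 0 := by
    rw [hDdet]; exact pow_ne_zero _ (by exact_mod_cast (Fact.out : p.Prime).ne_zero)
  have hk₁det0 : (k₁.map ι).det ≠ 0 := by
    rw [hι, ← RingHom.mapMatrix_apply, ← RingHom.map_det]
    intro h0
    have : ((k₁.det * k₁'.det : ℤ_[p]) : ℚ_[p]) = 0 := by
      push_cast; rw [show ((k₁.det : ℤ_[p]) : ℚ_[p]) = 0 from h0, zero_mul]
    rw [hk₁u] at this; exact one_ne_zero (by exact_mod_cast this)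
  have key : twist D (g.map ι) = h₀.map ι := by
    rw [← hgmap, ← hh₀map, ← h, hγeq, twist_smul hc0, ← twist_mul, ← twist_mul]
    congr 1
    rw [← Matrix.mul_assoc, ← Matrix.mul_assoc, ← Matrix.map_mul, hk₁,
      Matrix.map_one ι (map_zero ι) (map_one ι), Matrix.one_mul]
  -- read `key` as `(pⁿ)² · h₀ = g((x,y)·diag(pⁿ,1))` over `ℤ_p`
  have hDℤ : D = (!![(p : ℤ_[p]) ^ n, 0; 0, 1] : Matrix (Fin 2) (Fin 2) ℤ_[p]).map ι := by
    rw [hD]; ext i j; fin_cases i <;> fin_cases j <;> simp [hι]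
  have key' : (((p : ℤ_[p]) ^ n) ^ 2) • h₀ = g.subst !![(p : ℤ_[p]) ^ n, 0; 0, 1] := by
    apply map_injective_of_injective (φ := ι) (fun a b hab ↦ Subtype.ext hab)
    rw [map_smul_form, map_subst, ← hDℤ, ← key, twist, hDdet, smul_smul]
    have : ι (((p : ℤ_[p]) ^ n) ^ 2) * (((p : ℚ_[p]) ^ n) ^ 2)⁻¹ = 1 := by
      rw [hι, map_pow, map_pow, map_natCast]
      exact mul_inv_cancel₀ (pow_ne_zero _ (pow_ne_zero _
        (Nat.cast_ne_zero.mpr (Fact.out : p.Prime).ne_zero)))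
    rw [this, one_smul]
  have hgdisc := sq_dvd_disc_of_twisted_diagonal_integral_padicInt g h₀ hn key'
  -- `Δ(g) = (det k₂')¹² (det k₂)¹² Δ(f) = Δ(f)`
  rw [hg, disc_smul_form, disc_subst, ← mul_assoc, ← pow_mul, ← mul_pow,
    mul_comm k₂'.det, hk₂u, one_pow, one_mul] at hgdisc
  exact hgdisc

/-- **The general form of the weight half** (covering stabilisers as well): if `γ ∈ GL₂(ℚ_p)`
carries `f ∈ V_{ℤ_p}` to an integral form `f'` and `γ ∉ ℚ_pˣ · GL₂(ℤ_p)`, then `p² ∣ Δ(f)`.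
(With `f' = f`: a `ℚ_p`-automorphism of `f` not coming from `GL₂(ℤ_p)` forces `p² ∣ Δ(f)`; this is
the part of `m_p(f) ≠ 1 ⇒ p² ∣ Δ(f)` concerning `#Aut_{ℚ_p}(f) ≠ #Aut_{ℤ_p}(f)` in Prop. 3.18 of the
published version.) [cite: BhargavaShankarAnnals2015, Prop. 5.13, proof (arXiv:1006.1002v2 numbering)] -/
theorem sq_dvd_disc_of_twist_integral_of_not_scalar_mul_integral (f f' : BinaryQuartic ℤ_[p])
    {γ : Matrix (Fin 2) (Fin 2) ℚ_[p]} (hγ : γ.det ≠ 0)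
    (h : twist γ (f.map PadicInt.Coe.ringHom) = f'.map PadicInt.Coe.ringHom)
    (hnot : ¬ ∃ (c : ℚ_[p]) (k : Matrix (Fin 2) (Fin 2) ℤ_[p]), c ≠ 0 ∧ IsUnit k.det ∧
      γ = c • k.map PadicInt.Coe.ringHom) :
    (p : ℤ_[p]) ^ 2 ∣ f.disc := by
  obtain ⟨c, n, k₁, k₁', k₂, k₂', hc0, hk₁, hk₂, hγeq⟩ := exists_cartan_decomposition hγ
  set ι := PadicInt.Coe.ringHom (p := p) with hι
  have hk₁u : k₁.det * k₁'.det = 1 := by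
    rw [mul_comm, ← Matrix.det_mul, hk₁, Matrix.det_one]
  have hk₂u : k₂.det * k₂'.det = 1 := by rw [← Matrix.det_mul, hk₂, Matrix.det_one]
  have hk₁'u : k₁'.det * k₁.det = 1 := by rw [mul_comm]; exact hk₁u
  -- `n ≥ 1`: otherwise `γ = c · (k₁ k₂)`
  have hn : 1 ≤ n := by
    by_contra hn0
    have hn0' : n = 0 := by omega
    apply hnot
    refine ⟨c, k₁ * k₂, hc0, ?_, ?_⟩
    · rw [Matrix.det_mul]
      exact (isUnit_iff_exists_inv.mpr ⟨_, hk₁u⟩).mul (isUnit_iff_exists_inv.mpr ⟨_, hk₂u⟩)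
    · rw [hγeq, hn0', pow_zero, Matrix.map_mul, show (!![1, 0; 0, 1] : Matrix (Fin 2) (Fin 2) ℚ_[p])
        = 1 from (Matrix.one_fin_two).symm, Matrix.mul_one]
  set g : BinaryQuartic ℤ_[p] := (k₂'.det ^ 2) • f.subst k₂ with hg
  set h₀ : BinaryQuartic ℤ_[p] := (k₁.det ^ 2) • f'.subst k₁' with hh₀
  have hgmap : twist (k₂.map ι) (f.map ι) = g.map ι := by
    rw [hg, hι]; exact twist_map_of_det_unit f hk₂u
  have hh₀map : twist (k₁'.map ι) (f'.map ι) = h₀.map ι := by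
    rw [hh₀, hι]; exact twist_map_of_det_unit f' hk₁'u
  set D : Matrix (Fin 2) (Fin 2) ℚ_[p] := !![(p : ℚ_[p]) ^ n, 0; 0, 1] with hD
  have hDdet : D.det = (p : ℚ_[p]) ^ n := by rw [hD, Matrix.det_fin_two_of]; ring
  have key : twist D (g.map ι) = h₀.map ι := by
    rw [← hgmap, ← hh₀map, ← h, hγeq, twist_smul hc0, ← twist_mul, ← twist_mul]
    congr 1
    rw [← Matrix.mul_assoc, ← Matrix.mul_assoc, ← Matrix.map_mul, hk₁,
      Matrix.map_one ι (map_zero ι) (map_one ι), Matrix.one_mul]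
  have hDℤ : D = (!![(p : ℤ_[p]) ^ n, 0; 0, 1] : Matrix (Fin 2) (Fin 2) ℤ_[p]).map ι := by
    rw [hD]; ext i j; fin_cases i <;> fin_cases j <;> simp [hι]
  have key' : (((p : ℤ_[p]) ^ n) ^ 2) • h₀ = g.subst !![(p : ℤ_[p]) ^ n, 0; 0, 1] := by
    apply map_injective_of_injective (φ := ι) (fun a b hab ↦ Subtype.ext hab)
    rw [map_smul_form, map_subst, ← hDℤ, ← key, twist, hDdet, smul_smul]
    have : ι (((p : ℤ_[p]) ^ n) ^ 2) * (((p : ℚ_[p]) ^ n) ^ 2)⁻¹ = 1 := by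
      rw [hι, map_pow, map_pow, map_natCast]
      exact mul_inv_cancel₀ (pow_ne_zero _ (pow_ne_zero _
        (Nat.cast_ne_zero.mpr (Fact.out : p.Prime).ne_zero)))
    rw [this, one_smul]
  have hgdisc := sq_dvd_disc_of_twisted_diagonal_integral_padicInt g h₀ hn key'
  rw [hg, disc_smul_form, disc_subst, ← mul_assoc, ← pow_mul, ← mul_pow,
    mul_comm k₂'.det, hk₂u, one_pow, one_mul] at hgdisc
  exact hgdisc

/-- **Automorphisms: if `p² ∤ Δ(f)` then every `γ ∈ GL₂(ℚ_p)` with `γ · f = f` lies in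
`ℚ_pˣ · GL₂(ℤ_p)`** — `Aut_{ℚ_p}(f) = Aut_{ℤ_p}(f)` in `PGL₂`, the automorphism part of
`m_p(f) = 1` for forms with `p² ∤ Δ` (published version, Prop. 3.18).
[cite: BhargavaShankarAnnals2015, Prop. 5.13, proof (arXiv:1006.1002v2 numbering)] -/
theorem exists_scalar_mul_integral_of_twist_eq_self (f : BinaryQuartic ℤ_[p])
    (hΔ : ¬ (p : ℤ_[p]) ^ 2 ∣ f.disc) {γ : Matrix (Fin 2) (Fin 2) ℚ_[p]} (hγ : γ.det ≠ 0)
    (h : twist γ (f.map PadicInt.Coe.ringHom) = f.map PadicInt.Coe.ringHom) :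
    ∃ (c : ℚ_[p]) (k : Matrix (Fin 2) (Fin 2) ℤ_[p]), c ≠ 0 ∧ IsUnit k.det ∧
      γ = c • k.map PadicInt.Coe.ringHom := by
  by_contra hnot
  exact hΔ (sq_dvd_disc_of_twist_integral_of_not_scalar_mul_integral f f hγ h hnot)

/-- **Classes: if `p² ∤ Δ(f)` then every integral form `PGL₂(ℚ_p)`-equivalent to `f` is
`PGL₂(ℤ_p)`-equivalent to it** — the class part of `m_p(f) = 1` (published version, Prop. 3.18).
[cite: BhargavaShankarAnnals2015, Prop. 5.13, proof (arXiv:1006.1002v2 numbering)] -/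
theorem exists_integral_twist_of_not_sq_dvd_disc (f f' : BinaryQuartic ℤ_[p])
    (hΔ : ¬ (p : ℤ_[p]) ^ 2 ∣ f.disc) {γ : Matrix (Fin 2) (Fin 2) ℚ_[p]} (hγ : γ.det ≠ 0)
    (h : twist γ (f.map PadicInt.Coe.ringHom) = f'.map PadicInt.Coe.ringHom) :
    ∃ k : Matrix (Fin 2) (Fin 2) ℤ_[p], IsUnit k.det ∧
      twist (k.map PadicInt.Coe.ringHom) (f.map PadicInt.Coe.ringHom) = f'.map PadicInt.Coe.ringHom := by
  by_contra hnot
  exact hΔ (sq_dvd_disc_of_pgl2Q_equiv_not_pgl2Z_equiv f f' hγ h hnot)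

end BinaryQuartic

end Literature.NumberTheory.EllipticCurves

end
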